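import Summits.BirchSwinnertonDyer.Rank1Residual.Additive.QuadraticBranchCharacterEvaluation
import Summits.BirchSwinnertonDyer.Rank1Residual.Additive.QuadraticBranchSignedMainConjecture
import Summits.BirchSwinnertonDyer.Rank1Residual.Additive.SemistableTwistAnalyticSigned
import Summits.BirchSwinnertonDyer.Rank1Residual.Additive.GordTwistMinimalModel
import Summits.BirchSwinnertonDyer.Rank1Residual.Additive.QuadraticBranchLFunctionNeZero
import Literature.NumberTheory.EllipticCurves.LeadingTermBSZOrdinaryProofs
import Literature.NumberTheory.EllipticCurves.BSDQuadraticDescentPeriodEliminationProofs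
import HarnessLib

/-!
# The VALUE identity on the even quadratic branch: `v_p(L_p⁺(V, η, 0)) = v_p(L(W,1)/Ω_W)` for the
# `p*`-twist `W` of a good `a_p = 0` curve `V` (cell `bsd-potss`, seat `bsd-potss-ctrl` g2; the
# `hval` / `h0` binders of the T-e2-r0 consumers, TARGET.md v2 §1.1, DISCHARGED)

HONEST FRAMING (cell `bsd-potss`, run/shared/lean/pub/bsd-potss/; FULL-BSD rank ≤ 1 programme,
tranche 1b): THEOREMS ONLY — no definition, no named Literature fact, no Summits-side fact
`def … : Prop`, no `sorry`, axioms standard. The only named-fact input is modularity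
(`hmod : hasEntireLFunction_rat`, displayed), exactly as in the tree's Birch-formula theorems
`entireLFunction_one_eq_of_twist_pos` / `_neg_signed` (x1b census files) which this file composes
with g0's `IsQuadraticBranchPlusLFunction.constantCoeff` (Kobayashi (3.6)). Nothing is booked; no
label / mark / count moves; nothing about (C1_η) or `BSD(W, p)` of any pair is claimed.

## What

* §1 `teichSign_eq_legendreSym` — Euler's criterion for Teichmüller representatives: `η(w) = (w̄/p)`.
* §2 `apply_eq_legendreSym_of_orderOf_eq_two` — a character mod `p` of ORDER 2 with values in `ℂ_p`
  IS the Legendre symbol (units: `b = w̄`, `ψ(w̄) = η(w)` by g0's `apply_toZModPow_eq_teichSign`).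
* §3 `ratTwistedSymbolSum_eq_legendrePlusSymbolSum` / `ratMinusTwistedSymbolSum_eq_legendreMinusSymbolSum`
  — hence Birch's sums agree: `∑_{b mod p} ψ(b)[b/p]^±_f = legendre{Plus,Minus}SymbolSum f p` in `ℂ_p`.
* §4 **`IsQuadraticBranchPlusLFunction.valuation_constantCoeff_eq`** — for ANY `L` with Kobayashi's
  plus interpolation property (`p` odd): `v_p(L(0)) = v_p(ϖ · legendre{Plus|Minus}SymbolSum f p)`
  according as `p ≡ 1, 3 (mod 4)` (`L(0) = −u·ϖ·∑ψ(b)[b/p]^δ_f`, `u ∈ ℤ_p^×`: (3.6)), and `L(0) ≠ 0`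
  as soon as that rational is non-zero.
* §5 **`valuation_constantCoeff_eq_padicValRat_of_twist`** — THE VALUE IDENTITY: for `W` the
  `p*`-twist of a globally minimal good-at-`p` curve `V` (`C • W^{(p*)} = V`, `p` odd), `f` the
  newform of `V`, `ϖ` the period ratio of the parity of `η`, ANY such `L`, ANY rational `q` with
  `L(W,1)/Ω_W = q`: **`v_p(L(0)) = v_p(q)`**, and `L(W,1) ≠ 0 → L(0) ≠ 0` — Birch's formula for the
  twist (`L(W,1) = ϖ·S⁺·Ω_W`, resp. `ϖ·S⁻·Ω_W/c_∞`, `c_∞ ∈ {1,2}` a `p`-adic unit) against (3.6).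

References: [Kobayashi2003] (3.6) (p. 7), §3 (p. 5); [MazurTateTeitelbaum1986Invent] §I.8 (8.6),
§I.13; [Pal2012] Thm. 3.2; [SilvermanAEC2009] VII.5 Prop. 5.1; [Washington1997] §7.2.
-/

noncomputable section

open scoped Classical MatrixGroups ModularForm

open CongruenceSubgroup Polynomial WeierstrassCurve Literature.NumberTheory.EllipticCurves
  Literature.NumberTheory.EllipticCurves.ModularForms
  Literature.NumberTheory.EllipticCurves.Kobayashi2003
  Literature.NumberTheory.EllipticCurves.Rank1Residual
  Literature.NumberTheory.EllipticCurves.IwasawaAlgebra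

namespace Summit.BirchSwinnertonDyer.Rank1Residual.Additive

/-! ## §1 Euler's criterion for Teichmüller representatives -/

section Euler

variable (p : ℕ) [hp : Fact p.Prime]

/-- **`η(w) = (w̄/p)`**: for `w ∈ μ_{p−1}(ℤ_p)` (`p` odd) the sign `η(w) = w^{(p−1)/2} ∈ {±1}`
(`teichSign`) is the Legendre symbol of the reduction of `w` modulo `p` (read through any level
`p^K`, `K ≥ 1`): `w^{(p−1)/2} = ±1` in `ℤ_p`, and modulo `p` Euler's criterion `(a/p) ≡ a^{(p−1)/2}`
(`legendreSym.eq_pow`) decides which. [cite: Washington1997, §7.2] -/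
theorem teichSign_eq_legendreSym (hp2 : p ≠ 2) (w : rootsOfUnity (torsionOrder p) ℤ_[p])
    {K : ℕ} (hK : 1 ≤ K) :
    teichSign p w = legendreSym p ((PadicInt.toZModPow K ((w : ℤ_[p]ˣ) : ℤ_[p])).val : ℤ) := by
  have hP : p.Prime := hp.out
  haveI : Fact (2 < p) := ⟨lt_of_le_of_ne hP.two_le (Ne.symm hp2)⟩
  haveI : NeZero (p ^ K) := ⟨pow_ne_zero _ hP.ne_zero⟩
  set x : ℤ_[p] := ((w : ℤ_[p]ˣ) : ℤ_[p]) with hx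
  have hτ : torsionOrder p = p - 1 := by rw [torsionOrder_eq, if_neg hp2]
  have hodd : p % 2 = 1 := Nat.odd_iff.mp (hP.odd_of_ne_two hp2)
  have hhalf : torsionOrder p / 2 = p / 2 := by rw [hτ]; omega
  have hsum : p / 2 + p / 2 = torsionOrder p := by rw [hτ]; omega
  -- `x ^ (p-1) = 1`, so `y := x ^ (p/2)` satisfies `y² = 1`
  have hx1 : x ^ torsionOrder p = 1 := by
    have h := (mem_rootsOfUnity (torsionOrder p) (w : ℤ_[p]ˣ)).mp w.2
    have h' := congrArg Units.val h
    rwa [Units.val_pow_eq_pow_val, Units.val_one] at h'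
  have hy : x ^ (p / 2) = 1 ∨ x ^ (p / 2) = -1 := by
    apply mul_self_eq_one_iff.mp
    rw [← pow_add, hsum, hx1]
  -- reduction modulo `p` through the level `p^K`
  set φ : ℤ_[p] →+* ZMod p :=
    (ZMod.castHom (dvd_pow_self p (by omega) : p ∣ p ^ K) (ZMod p)).comp (PadicInt.toZModPow K) with hφ
  set b := PadicInt.toZModPow K x with hb
  have hbval : ((b.val : ℤ) : ZMod p) = φ x := by
    rw [Int.cast_natCast, ZMod.natCast_val, hφ, RingHom.comp_apply, ZMod.castHom_apply]
  have hleg : (legendreSym p (b.val : ℤ) : ZMod p) = φ (x ^ (p / 2)) := by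
    rw [legendreSym.eq_pow, hbval, map_pow]
  have hb0 : ((b.val : ℤ) : ZMod p) ≠ 0 := by
    rw [hbval]
    exact ((Units.isUnit (w : ℤ_[p]ˣ)).map φ).ne_zero
  rcases hy with h1 | h1
  · -- `η(w) = 1` and `(b/p) ≡ 1`
    have ht : teichSign p w = 1 := by rw [teichSign, hhalf, if_pos h1]
    rw [ht]
    rcases legendreSym.eq_one_or_neg_one p hb0 with h2 | h2
    · rw [h2]
    · exfalso
      rw [h1, map_one, h2, Int.cast_neg, Int.cast_one] at hleg
      exact ZMod.neg_one_ne_one hleg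
  · -- `η(w) = -1` and `(b/p) ≡ -1`
    have hne : x ^ (torsionOrder p / 2) ≠ 1 := by
      rw [hhalf, h1]
      exact fun h ↦ by
        have h2 : (2 : ℤ_[p]) = 0 := by linear_combination -h
        exact two_ne_zero h2
    have ht : teichSign p w = -1 := by rw [teichSign, if_neg hne]
    rw [ht]
    rcases legendreSym.eq_one_or_neg_one p hb0 with h2 | h2
    · exfalso
      rw [h1, map_neg, map_one, h2, Int.cast_one] at hleg
      exact ZMod.neg_one_ne_one hleg.symm
    · rw [h2]

end Euler

/-! ## §2 A character of order `2` modulo `p` is the Legendre symbol -/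

section Character

variable {p : ℕ} [hp : Fact p.Prime]

/-- **A character modulo `p` of order `2` with values in `ℂ_p` is the Legendre symbol** (`p` odd; the
level is written `p^{0 + e₀}`, `e₀ = 1`, to meet the tree's Teichmüller decomposition
`(ℤ/p^{n+e₀})^× = μ_{p−1} × Γ/Γ^{pⁿ}` at `n = 0`): on units `b = w̄` (`γ ≡ 1`), `ψ(w̄) = η(w)`
(`apply_toZModPow_eq_teichSign`) `= (b/p)` (§1); on non-units both sides vanish.
[cite: Washington1997, §7.2] [cite: Kobayashi2003, §3 (p. 5: the character η)] -/
theorem apply_eq_legendreSym_of_orderOf_eq_two (hp2 : p ≠ 2)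
    (ψ : DirichletCharacter ℂ_[p] (p ^ (0 + cyclotomicExponent p))) (hψ : orderOf ψ = 2)
    (b : ZMod (p ^ (0 + cyclotomicExponent p))) :
    ψ b = ((legendreSym p (b.val : ℤ) : ℤ) : ℂ_[p]) := by
  have hP : p.Prime := hp.out
  have he : cyclotomicExponent p = 1 := if_neg hp2
  haveI : NeZero (p ^ (0 + cyclotomicExponent p)) := ⟨pow_ne_zero _ hP.ne_zero⟩
  by_cases hb : IsUnit b
  · obtain ⟨w, s, hws⟩ := exists_classMap_eq_of_isUnit p 0 hb
    have hγ : (cyclotomicGenerator p : ZMod (p ^ (0 + cyclotomicExponent p))) = 1 := by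
      rw [cyclotomicGenerator, Nat.cast_add, Nat.cast_one, (ZMod.natCast_eq_zero_iff _ _).mpr
        (by rw [zero_add]), add_zero]
    rw [hγ, one_pow, mul_one] at hws
    rw [← hws, apply_toZModPow_eq_teichSign hp2 ψ (by rw [pow_zero, mul_one]; exact hψ) w,
      teichSign_eq_legendreSym p hp2 w (by omega : 1 ≤ 0 + cyclotomicExponent p)]
  · rw [MulChar.map_nonunit ψ hb]
    have h0 : ((b.val : ℤ) : ZMod p) = 0 := by
      by_contra hne
      apply hb
      rw [Int.cast_natCast, ZMod.natCast_eq_zero_iff] at hne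
      have hcop : Nat.Coprime b.val (p ^ (0 + cyclotomicExponent p)) :=
        Nat.Coprime.pow_right _ ((Nat.Prime.coprime_iff_not_dvd hP).mpr hne).symm
      rw [← ZMod.natCast_zmod_val b]
      exact (ZMod.isUnit_iff_coprime _ _).mpr hcop
    rw [(legendreSym.eq_zero_iff p _).mpr h0, Int.cast_zero]

variable {N : ℕ} (f : CuspForm (Gamma0 N) 2)

/-- Reindexing a sum over `ZMod m` along `m = p`. [folklore] -/
theorem sum_zmod_eq_of_eq (G : ℕ → ℂ_[p]) {m : ℕ} [NeZero m] [NeZero p] (hm : m = p) :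
    ∑ b : ZMod m, G b.val = ∑ a : ZMod p, G a.val := by subst hm; rfl

/-- **The plus Birch sum at an order-`2` character is the Legendre-twisted plus sum**:
`∑_{b mod p} ψ(b)[b/p]⁺_f = ∑_{a mod p} (a/p)[a/p]⁺_f` (the tree's rational
`legendrePlusSymbolSum f p`, cast to `ℂ_p`). [cite: MazurTateTeitelbaum1986Invent, §I.8 (8.6)] -/
theorem ratTwistedSymbolSum_eq_legendrePlusSymbolSum (hp2 : p ≠ 2)
    (ψ : DirichletCharacter ℂ_[p] (p ^ (0 + cyclotomicExponent p))) (hψ : orderOf ψ = 2) :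
    haveI : NeZero (p ^ (0 + cyclotomicExponent p)) := ⟨pow_ne_zero _ hp.out.ne_zero⟩
    ratTwistedSymbolSum f ψ = ((legendrePlusSymbolSum f p : ℚ) : ℂ_[p]) := by
  have hP : p.Prime := hp.out
  have he : cyclotomicExponent p = 1 := if_neg hp2
  have hm : p ^ (0 + cyclotomicExponent p) = p := by rw [he, zero_add, pow_one]
  haveI : NeZero (p ^ (0 + cyclotomicExponent p)) := ⟨pow_ne_zero _ hP.ne_zero⟩
  unfold ratTwistedSymbolSum
  rw [legendrePlusSymbolSum_def]
  push_cast
  simp_rw [apply_eq_legendreSym_of_orderOf_eq_two hp2 ψ hψ]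
  haveI : NeZero p := ⟨hP.ne_zero⟩
  rw [show ((p : ℚ) ^ (0 + cyclotomicExponent p)) = p by rw [he, zero_add, pow_one]]
  exact sum_zmod_eq_of_eq (p := p)
    (fun i ↦ ((legendreSym p (i : ℤ) : ℤ) : ℂ_[p]) * ((ratPlusSymbol f ((i : ℚ) / p) : ℚ) : ℂ_[p])) hm

/-- **The minus Birch sum at an order-`2` character is the Legendre-twisted minus sum**:
`∑_{b mod p} ψ(b)[b/p]⁻_f = ∑_{a mod p} (a/p)[a/p]⁻_f` (`legendreMinusSymbolSum f p` cast to `ℂ_p`).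
[cite: MazurTateTeitelbaum1986Invent, §I.8 (8.6)] -/
theorem ratMinusTwistedSymbolSum_eq_legendreMinusSymbolSum (hp2 : p ≠ 2)
    (ψ : DirichletCharacter ℂ_[p] (p ^ (0 + cyclotomicExponent p))) (hψ : orderOf ψ = 2) :
    haveI : NeZero (p ^ (0 + cyclotomicExponent p)) := ⟨pow_ne_zero _ hp.out.ne_zero⟩
    ratMinusTwistedSymbolSum f ψ = ((legendreMinusSymbolSum f p : ℚ) : ℂ_[p]) := by
  have hP : p.Prime := hp.out
  have he : cyclotomicExponent p = 1 := if_neg hp2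
  have hm : p ^ (0 + cyclotomicExponent p) = p := by rw [he, zero_add, pow_one]
  haveI : NeZero (p ^ (0 + cyclotomicExponent p)) := ⟨pow_ne_zero _ hP.ne_zero⟩
  unfold ratMinusTwistedSymbolSum
  rw [legendreMinusSymbolSum_def]
  push_cast
  simp_rw [apply_eq_legendreSym_of_orderOf_eq_two hp2 ψ hψ]
  haveI : NeZero p := ⟨hP.ne_zero⟩
  rw [show ((p : ℚ) ^ (0 + cyclotomicExponent p)) = p by rw [he, zero_add, pow_one]]
  exact sum_zmod_eq_of_eq (p := p)
    (fun i ↦ ((legendreSym p (i : ℤ) : ℤ) : ℂ_[p]) * ((ratMinusSymbol f ((i : ℚ) / p) : ℚ) : ℂ_[p])) hm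

end Character

/-! ## §4 The valuation of `L_p⁺(V, η, 0)` -/

section Valuation

variable {N : ℕ} {f : CuspForm (Gamma0 N) 2} {p : ℕ} [hp : Fact p.Prime]

/-- A `p`-adic unit has valuation `0` in `ℚ_p`. [folklore] -/
theorem valuation_coe_units_eq_zero (v : ℤ_[p]ˣ) : (((v : ℤ_[p]) : ℚ_[p])).valuation = 0 := by
  have h1 : ((v : ℤ_[p]) * ((v⁻¹ : ℤ_[p]ˣ) : ℤ_[p])).valuation = 0 := by
    rw [Units.mul_inv, PadicInt.valuation_one]
  rw [PadicInt.valuation_mul (Units.ne_zero v) (Units.ne_zero v⁻¹)] at h1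
  rw [PadicInt.valuation_coe]
  exact_mod_cast Nat.eq_zero_of_add_eq_zero_right h1

/-- **An order-`2` character at level `p^{0+e₀}` and its Birch sum.** There is `ψ` modulo
`p^{0+e₀}` (`e₀ = cyclotomicExponent p = 1`, `p` odd) of order `2` — the Legendre character — and for
EVERY such `ψ` the branch Birch sum `∑ ψ(b)[b/p]^δ_f` is the rational `legendre{Plus|Minus}SymbolSum f p`
(§3). Stated with the level exponent generalised (`K = 0 + e₀`) so that it transports to the
tree's level `p^{0+1}` of `IsQuadraticBranchPlusLFunction.constantCoeff`. [cite: MazurTateTeitelbaum1986Invent, §I.8 (8.6)] -/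
theorem exists_orderOf_eq_two_and_forall_branchSum_eq (hp2 : p ≠ 2) (K : ℕ)
    (hK : K = 0 + cyclotomicExponent p) :
    haveI : NeZero (p ^ K) := ⟨pow_ne_zero _ hp.out.ne_zero⟩
    (∃ ψ : DirichletCharacter ℂ_[p] (p ^ K), orderOf ψ = 2) ∧
      ∀ ψ : DirichletCharacter ℂ_[p] (p ^ K), orderOf ψ = 2 →
        (if Even (p / 2) then ratTwistedSymbolSum f ψ else ratMinusTwistedSymbolSum f ψ) =
          ((if Even (p / 2) then legendrePlusSymbolSum f p else legendreMinusSymbolSum f p : ℚ) :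
            ℂ_[p]) := by
  subst hK
  have hP : p.Prime := hp.out
  haveI : NeZero (p ^ (0 + cyclotomicExponent p)) := ⟨pow_ne_zero _ hP.ne_zero⟩
  refine ⟨?_, fun ψ hψ ↦ ?_⟩
  · set qK : DirichletCharacter ℂ_[p] p := (quadraticChar (ZMod p)).ringHomComp (Int.castRingHom ℂ_[p])
      with hqK
    have hq : orderOf qK = 2 := orderOf_quadraticChar_ringHomComp_of_charZero ℂ_[p] hp2
    have he : cyclotomicExponent p = 1 := if_neg hp2
    have hdvd : p ∣ p ^ (0 + cyclotomicExponent p) := dvd_pow_self p (by rw [he]; omega)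
    refine ⟨DirichletCharacter.changeLevel hdvd qK, ?_⟩
    rw [orderOf_injective (DirichletCharacter.changeLevel hdvd)
      (DirichletCharacter.changeLevel_injective hdvd) qK, hq]
  · split_ifs with hev
    · rw [ratTwistedSymbolSum_eq_legendrePlusSymbolSum f hp2 ψ hψ]
    · rw [ratMinusTwistedSymbolSum_eq_legendreMinusSymbolSum f hp2 ψ hψ]

/-- **`v_p(L_p⁺(V, η, 0)) = v_p(ϖ · ∑_{a mod p} (a/p)[a/p]^δ_f)`** for ANY `L` with Kobayashi's plus
interpolation property on the quadratic branch (`p` odd): by (3.6) (`constantCoeff`)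
`L(0) = −u·ϖ·∑ ψ(b)[b/p]^δ_f` with `u ∈ ℤ_p^×` and `ψ` the quadratic character (§3), read in `ℚ_p`;
moreover `L(0) ≠ 0` as soon as that rational sum (times `ϖ`) is non-zero.
[cite: Kobayashi2003, (3.6) (p. 7)] [cite: MazurTateTeitelbaum1986Invent, §I.8 (8.6)] -/
theorem IsQuadraticBranchPlusLFunction.valuation_constantCoeff_eq (hp2 : p ≠ 2) {ϖ : ℚ}
    {L : IwasawaAlgebra p} (hL : IsQuadraticBranchPlusLFunction f p ϖ L) :
    ((PowerSeries.constantCoeff L : ℤ_[p]) : ℚ_[p]).valuation =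
        padicValRat p (ϖ * (if Even (p / 2) then legendrePlusSymbolSum f p else legendreMinusSymbolSum f p)) ∧
      (ϖ * (if Even (p / 2) then legendrePlusSymbolSum f p else legendreMinusSymbolSum f p) ≠ 0 →
        PowerSeries.constantCoeff L ≠ 0) := by
  have hP : p.Prime := hp.out
  have he : cyclotomicExponent p = 1 := if_neg hp2
  set S : ℚ := (if Even (p / 2) then legendrePlusSymbolSum f p else legendreMinusSymbolSum f p) with hS
  obtain ⟨u, hu⟩ := hL.constantCoeff
  obtain ⟨⟨ψ, hψ⟩, hall⟩ := exists_orderOf_eq_two_and_forall_branchSum_eq (f := f) hp2 (0 + 1) (by rw [he])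
  have h1 := hu ψ hψ
  rw [hall ψ hψ, ← hS] at h1
  -- read the identity in `ℚ_p`
  have h2 : ((PowerSeries.constantCoeff L : ℤ_[p]) : ℚ_[p]) =
      (((-u : ℤ_[p]ˣ) : ℤ_[p]) : ℚ_[p]) * ((ϖ * S : ℚ) : ℚ_[p]) := by
    apply (algebraMap ℚ_[p] ℂ_[p]).injective
    have e1 : ((S : ℚ) : ℂ_[p]) = algebraMap ℚ_[p] ℂ_[p] ((S : ℚ) : ℚ_[p]) := by
      rw [map_ratCast]
    have h1' : algebraMap ℚ_[p] ℂ_[p] ((PowerSeries.constantCoeff L : ℤ_[p]) : ℚ_[p]) =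
        -(algebraMap ℚ_[p] ℂ_[p] (((u : ℤ_[p]) : ℚ_[p]) * (ϖ : ℚ_[p])) * ((S : ℚ) : ℂ_[p])) := h1
    rw [h1', e1, ← map_mul, ← map_neg]
    congr 1
    push_cast
    ring
  refine ⟨?_, fun hne h0 ↦ ?_⟩
  · rw [h2]
    by_cases h0 : ϖ * S = 0
    · rw [h0, Rat.cast_zero, mul_zero, Padic.valuation_zero, padicValRat.zero]
    · rw [Padic.valuation_mul (PadicInt.coe_ne_zero.mpr (Units.ne_zero (-u))) (by exact_mod_cast h0),
        valuation_coe_units_eq_zero, Padic.valuation_ratCast, zero_add]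
  · have h3 : ((PowerSeries.constantCoeff L : ℤ_[p]) : ℚ_[p]) = 0 := by rw [h0, PadicInt.coe_zero]
    rw [h2, mul_eq_zero] at h3
    rcases h3 with h3 | h3
    · exact (PadicInt.coe_ne_zero.mpr (Units.ne_zero (-u))) h3
    · exact hne (by exact_mod_cast h3)

end Valuation

/-! ## §5 The value identity for the `p*`-twist -/

section Twist

open Literature.NumberTheory.EllipticCurves.Rank1Residual.Typed Rat.HeightOneSpectrum

variable (p : ℕ) [hp : Fact p.Prime] {N : ℕ} [NeZero N] {f : CuspForm (Gamma0 N) 2}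

/-- `p` odd: `p ≡ 1 (mod 4)` iff `⌊p/2⌋` is even. [folklore] -/
theorem even_half_iff_mod_four (hp2 : p ≠ 2) : Even (p / 2) ↔ p % 4 = 1 := by
  have hodd : p % 2 = 1 := Nat.odd_iff.mp (hp.out.odd_of_ne_two hp2)
  constructor
  · rintro ⟨k, hk⟩; omega
  · intro h; exact ⟨p / 4, by omega⟩

/-- **THE VALUE IDENTITY `v_p(L_p⁺(V, η, 0)) = v_p(L(W,1)/Ω_W)`.** For `W` globally minimal, the
`p*`-twist of a globally minimal curve `V` good at the odd prime `p` (`C • W^{(p*)} = V`), `f` the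
newform of `V`, `ϖ` the period ratio of the parity of `η`, ANY `L` with
`IsQuadraticBranchPlusLFunction f p ϖ L`, and ANY rational `q` with `L(W,1)/Ω_W = q`:
`v_p(L(0)) = v_p(q)`, and `L(W,1) ≠ 0 → L(0) ≠ 0`. Birch's formula for the twist — the tree's
`entireLFunction_one_eq_of_twist_pos` (`p ≡ 1 (4)`: `L(W,1) = ϖ S⁺ Ω_W`) /
`entireLFunction_one_eq_of_twist_neg_signed` (`p ≡ 3 (4)`: `L(W,1) = ϖ S⁻ Ω_W / c_∞`, `c_∞ ∈ {1,2}`),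
Pal's period relation and Gauss's sign inside — against (3.6) (§4). Modularity displayed (`hmod`).
[cite: Kobayashi2003, (3.6) (p. 7)] [cite: MazurTateTeitelbaum1986Invent, §I.8 (8.6)]
[cite: Pal2012, Thm. 3.2] [cite: SilvermanAEC2009, VII.5 Prop. 5.1] -/
theorem valuation_constantCoeff_eq_padicValRat_of_twist (hmod : hasEntireLFunction_rat) (hp2 : p ≠ 2)
    (W V : WeierstrassCurve ℚ) [W.IsElliptic] [W.IsGloballyMinimal] [V.IsElliptic] [V.IsGloballyMinimal]
    (C : VariableChange ℚ) (hCV : C • W.quadraticTwist ((-1) ^ (p / 2) * p) = V)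
    (hgood : V.HasGoodReductionAtPrime p) (hf : IsNewformOf V f) {ϖ : ℚ}
    (hϖ : if Even (p / 2) then (ϖ : ℝ) * V.realPeriodRat = plusPeriod f
      else (ϖ : ℝ) * V.imaginaryPeriodRat = minusPeriod f)
    {L : IwasawaAlgebra p} (hL : IsQuadraticBranchPlusLFunction f p ϖ L)
    {q : ℚ} (hq : W.entireLFunction 1 / (W.realPeriodRat : ℂ) = (q : ℂ)) :
    ((PowerSeries.constantCoeff L : ℤ_[p]) : ℚ_[p]).valuation = padicValRat p q ∧
      (W.entireLFunction 1 ≠ 0 → PowerSeries.constantCoeff L ≠ 0) := by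
  have hP : p.Prime := hp.out
  have hd : ((-1 : ℚ) ^ (p / 2) * p) ≠ 0 :=
    mul_ne_zero (pow_ne_zero _ (neg_ne_zero.mpr one_ne_zero)) (Nat.cast_ne_zero.mpr hP.ne_zero)
  haveI := W.isElliptic_quadraticTwist hd
  -- the twist read backwards, `Addv W p`
  obtain ⟨C', hC'⟩ := exists_variableChange_quadraticTwist_symm (W := V) W hd ⟨C, hCV⟩
  have hjW : 0 ≤ padicValRat p W.j := by
    have htw : (W.quadraticTwist ((-1 : ℚ) ^ (p / 2) * p)).HasGoodReductionAtPrime p := by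
      rw [← hCV] at hgood
      exact (BSZLemma17.hasGoodReductionAtPrime_smul_iff _ C p).mp hgood
    exact padicValRat_j_nonneg_of_typeG W p (typeG_of_hasGoodReductionAtPrime_quadraticTwist W p hp2 htw)
  have hjV : 0 ≤ padicValRat p V.j := by
    have e : V.j = W.j := by subst hCV; rw [variableChange_j, j_quadraticTwist W hd]
    exact e ▸ hjW
  have hΔV : padicValInt p V.minimalDiscriminantInt < 6 := by
    rw [padicValInt.eq_zero_of_not_dvd (not_dvd_minimalDiscriminantInt_of_hasGoodReductionAtPrime' V p hgood)]
    norm_num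
  obtain ⟨hadd, -, -⟩ := addv_of_twist_pStar p hp2 V W hjV hΔV C' hC'
  have hΩ : (W.realPeriodRat : ℂ) ≠ 0 := by exact_mod_cast W.realPeriodRat_pos_holds.ne'
  obtain ⟨hval, hne⟩ := hL.valuation_constantCoeff_eq hp2
  -- Birch's formula, by the residue of `p` mod `4`
  by_cases hev : Even (p / 2)
  · have hp4 : p % 4 = 1 := (even_half_iff_mod_four p hp2).mp hev
    rw [if_pos hev] at hϖ hval hne
    have hC'' : C' • V.quadraticTwist (p : ℚ) = W := by
      rw [← hC', hev.neg_one_pow, one_mul]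
    have hB := entireLFunction_one_eq_of_twist_pos p hmod hp4 V W C' hC'' (Or.inl hgood) hadd hf ϖ hϖ
    have hqS : q = ϖ * legendrePlusSymbolSum f p := by
      have h : ((q : ℚ) : ℂ) = ((ϖ * legendrePlusSymbolSum f p : ℚ) : ℂ) := by
        rw [← hq, hB, mul_div_assoc, div_self hΩ, mul_one]
      exact_mod_cast h
    refine ⟨by rw [hval, hqS], fun hLW ↦ hne fun h0 ↦ hLW ?_⟩
    rw [hB, ← hqS]
    have : q = 0 := by rw [hqS, h0]
    rw [this, Rat.cast_zero, zero_mul]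
  · have hp4 : p % 4 = 3 := by
      have hodd : p % 2 = 1 := Nat.odd_iff.mp (hP.odd_of_ne_two hp2)
      have h := (even_half_iff_mod_four p hp2).not.mp hev
      omega
    rw [if_neg hev] at hϖ hval hne
    have hodd' : Odd (p / 2) := Nat.not_even_iff_odd.mp hev
    have hC'' : C' • V.quadraticTwist (-(p : ℚ)) = W := by
      rw [← hC', hodd'.neg_one_pow, neg_one_mul]
    have hB := entireLFunction_one_eq_of_twist_neg_signed p hmod hp4 V W C' hC'' (Or.inl hgood) hadd hf ϖ hϖ
    set c := ((W.baseChange ℝ).numRealComponents : ℚ) with hc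
    have hc0 : c ≠ 0 := by
      rw [hc]; exact_mod_cast (W.baseChange ℝ).numRealComponents_pos.ne'
    have hcval : padicValRat p c = 0 := by
      rw [hc, W.numRealComponents_baseChange_real]
      split_ifs
      · rw [Nat.cast_ofNat, ← Nat.cast_ofNat, padicValRat.of_nat]
        exact_mod_cast padicValNat_primes hp2
      · rw [Nat.cast_one, padicValRat.one]
    have hqS : q = ϖ * legendreMinusSymbolSum f p / c := by
      have h : ((q : ℚ) : ℂ) = ((ϖ * legendreMinusSymbolSum f p / c : ℚ) : ℂ) := by
        rw [← hq, hB, mul_div_assoc, div_self hΩ, mul_one]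
      exact_mod_cast h
    refine ⟨?_, fun hLW ↦ hne fun h0 ↦ hLW ?_⟩
    · rw [hval, hqS]
      by_cases h0 : ϖ * legendreMinusSymbolSum f p = 0
      · rw [h0, zero_div]
      · rw [padicValRat.div h0 hc0, hcval, sub_zero]
    · rw [hB, ← hqS]
      have : q = 0 := by rw [hqS, h0, zero_div]
      rw [this, Rat.cast_zero, zero_mul]

end Twist

end Summit.BirchSwinnertonDyer.Rank1Residual.Additive

end
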